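import Literature.LinearAlgebra.TensorNetworks.QTTLaplaceMultiNeumann

/-!
# QTT structure of the multi-dimensional Laplace operator, III: periodic factors (Kazeev–Khoromskij 2012, Cor. 2.7, Thm. 4.1)

Kazeev–Khoromskij, *Low-rank explicit QTT representation of the Laplace operator and its
inverse*, SIAM J. Matrix Anal. Appl. 33 (2012) 742–758 [KazeevKhoromskij2012]; numbering of
the MPI MIS preprint 75/2010.  Continuation of `QTTLaplaceMulti` (Cor. 2.3–2.4: the `D`-dimensional
operator (3) with Dirichlet factors), `QTTLaplaceNeumannPeriodic` (Lem. 2.2: the one-dimensional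
periodic Laplacian `Δ_P` and its rank reduction to `2, 3, …, 3` through the bond matrices `Z` and
`L = [1 0 0; 0 1 1]`) and `QTTLaplaceMultiNeumann` (the block-diagonal supercore device `diag(C, I)`,
Cor. 2.5–2.6): here the last corollary of §2, the supercores of `Σ_k I ⊗ ⋯ ⊗ a_kΔ_k ⊗ ⋯ ⊗ I` whose
one-dimensional factors are periodic, `Δ_k = Δ_P^{(d)}`.

* THE REDUCED PERIODIC ROW.  The device of `QTTLaplaceMultiNeumann` needs a UNIFORM
  one-dimensional representation; for `Δ_P` we use the rank-`3` one hidden in Lem. 2.2: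
  `Δ_P^{(d)} = (1,1,1) ⋈ W ⋈ ⋯ ⋈ W ⋈ (2,-1,-1)ᵀ` with the Dirichlet core `W = [I J' J; 0 J 0; 0 0 J']`
  — the rank-`5` row `(1,0,0,1,1) ⋈ diag(W,J,J')^{⋈d}` swept through `Z` (`vecMul_chainProd_lapCore_per`,
  from `chainProd_lapPCore_mul_perZ` and `(1,0,0,1,1)·Z = (1,1,1)`), whose channel `0` is `𝟙[m = n]`
  (`vecMul_chainProd_lapCore_per_zero`) and whose closing by `(2,-1,-1)ᵀ` is `Δ_P^{(d)}(m,n)` for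
  every `d ≥ 0` (`vecMul_chainProd_lapCore_per_dotProduct`; `(I, P)·L = (I, P, P) = (1,1,1)·W`).
  Hence the middle supercore identity
  `E_P · diag(W,I)(i₁,j₁) ⋯ diag(W,I)(i_d,j_d) · B(c) = [𝟙[m=n] cΔ_P^{(d)}(m,n); 0 𝟙[m=n]]` with
  `E_P = [1 1 1 0; 0 0 0 1]` and Cor. 2.4's `B(c) = [1 2c; 0 -c; 0 -c; 0 1]`
  (`supBondL_mul_chainProd_mul_supBondR_per`), and the assembled `D·d`-site train `lapMultiPTrain`
  (bond dimension `4`, cores `diag(W, I)`, junction cores `diag(W,I) ⋈ B(a_k) ⋈ E_P`,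
  `perSupJunction_eq`) with `ttMatrix = laplaceMulti a (Δ_P^{(2^d)})` serialised dimension by
  dimension, `d ≥ 1` (`eval_lapMultiPTrain`, `ttMatrix_lapMultiPTrain`).
* COROLLARY 2.7, VERBATIM: the three displayed QTT decompositions — middle supercore
  `[I P 0; 0 0 I] ⋈ [I J' J 0; 0 J J' 0; 0 0 0 I] ⋈ [I J' J 0; 0 J 0 0; 0 0 J' 0; 0 0 0 I]^{⋈(d-3)}
   ⋈ [I a(2I-J-J'); 0 -aJ; 0 -aJ'; 0 I]` (`perSupFirst_mul_perSupSecond_mul_chainProd_mul_supLast`),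
  first supercore `[I P] ⋈ [I J' J; 0 J J'] ⋈ W^{⋈(d-3)} ⋈ [I a(2I-J-J'); 0 -aJ; 0 -aJ']`
  (`perFirst_mul_perSecond_mul_chainProd_mul_supLast₁`), last supercore
  `[I P 0; 0 0 I] ⋈ [I J' J 0; 0 J J' 0; 0 0 0 I] ⋈ diag(W, I)^{⋈(d-4)} ⋈ [aI aJ' aJ; 0 aJ 0; 0 0 aJ'; ½I -½I -½I]
   ⋈ [2I-J-J'; -J; -J']` (`perSupFirst_mul_perSupSecond_mul_chainProd_mul_supPenult_mul_lapLast`, over a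
  field with `2 ≠ 0`; unreduced form `…_mul_supLastCol`).  The new cores are the head
  `[I P 0; 0 0 I]` (`perSupFirst`, `P = J + J'` of eq. (7)) and `[I J' J 0; 0 J J' 0; 0 0 0 I]`
  (`perSupSecond`); the middle core `diag(W, I)` (`lapSupCore`, `supCore_lapCore`), the last cores
  `supLast`, `supLast₁`, the penultimate core `supPenult` and `lapLast` are those of Cor. 2.4 / Lem. 2.1
  already in the library, and `[I P]`, `[I J' J; 0 J J']` (`perFirst`, `perSecond`) those of Lem. 2.2.
  The head is bridged to the device by `[I P 0; 0 0 I] ⋈ diag(L, 1) = E_P ⋈ diag(W, I)`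
  (`perSupFirst_mul_perSupM`) and `[I J' J 0; 0 J J' 0; 0 0 0 I] = diag(L, 1) ⋈ diag(W, I)`
  (`perSupSecond_eq`); the tail by Cor. 2.4's sweep `Z(a)·(W ⋈ (2,-1,-1)ᵀ) = diag(W,I)·(B(a) ⋈ (0,1)ᵀ)`
  (`supZ_mulVec_lapCore_mulVec_per`).
* THEOREM 4.1, line `Δ_P^{(d…d)} : 2, 3…3, 2, 3, 4…4, 2, …, 2, 3, 4…4, 3`, as unfolding-rank bounds of
  the assembled train: `rank_unfolding_lapMultiPTrain_le` (`≤ 4`), `…_junction_le` (`≤ 2` between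
  dimensions), `…_head_le` (`≤ 3` inside the first supercore), `…_first_le` (`≤ 2` across the first
  bond, `d ≥ 2`), `…_postJunction_le` (`≤ 3` after the first site of every later dimension, `d ≥ 2`),
  `…_last_le` (`≤ 3` across the last bond).

Reading notes.  (1) The displayed cores are block matrices with blank entries `= 0`.  (2) Exponents:
Cor. 2.7 is stated for `d ≥ 4`; our versions are indexed by the number `k` of generic middle cores,
so the middle / first / unreduced-last displays hold for every `d = k + 3 ≥ 3`, the reduced last
display for `d = k + 4`, and the uniform-form identity for every `d ≥ 0` (with the convention of
`laplaceP` for `2^d ≤ 2`: `Δ_P^{(1)} = [2 -2; -2 2]`, `Δ_P^{(0)} = 0`).  (3) The train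
`lapMultiPTrain` is the uniform-bond-dimension-`4` form; the paper's bond dimensions `2`, `3` at the
heads, tails and junctions are recovered as the unfolding-rank bounds of Thm. 4.1.

Not formalised here (honest scope).  Distinct level numbers `d_k` per dimension (we take all
`d_k = d`); mixed boundary conditions across dimensions (each assembled train of this series uses
one factor type for all `k`, although the device takes any uniform representation per train); the
minimality discussion of the ranks (Rem. 4.2) — upper bounds only; §3 (inverse Laplacian, see
`QTTLaplaceInverse`) and §5 (operator TT ranks, numerics).

## References
* [KazeevKhoromskij2012] V. A. Kazeev, B. N. Khoromskij, Low-rank explicit QTT representation of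
  the Laplace operator and its inverse, SIAM J. Matrix Anal. Appl. 33(3) (2012) 742–758
  (MPI MIS preprint 75/2010), Cor. 2.3, 2.4, 2.7, Rem. 1.2, Lem. 2.2, Thm. 4.1.

AI-produced formalisation (H21 engines group, seat eng-quad-2, 2026-08-23); no facts, no axioms
beyond Mathlib's, no `sorry`.
-/

namespace Literature.LinearAlgebra.TensorNetworks

universe u

open Matrix Finset

/-! ### Corollary 2.7: the supercores with the periodic factor `Δ_P` -/

section PeriodicBonds

variable (K : Type u) [CommRing K]

/-- THE FIRST QTT CORE `[I P 0; 0 0 I]` (`2 × 3`, `P = J + J'` of eq. (7), blank = zero block) of the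
middle supercore `[I^{⊗d} a_kΔ_P^{(d)}; 0 I^{⊗d}]` of Cor. 2.7 (first display; also the first core of
its third display).  [cite: KazeevKhoromskij2012, Cor. 2.7] -/
def perSupFirst (p : Fin 2 × Fin 2) : Matrix (Fin 2) (Fin 3) K :=
  !![blkI K p, blkJ K p + blkJ' K p, 0; 0, 0, blkI K p]

/-- THE SECOND QTT CORE `[I J' J 0; 0 J J' 0; 0 0 0 I]` (`3 × 4`) of Cor. 2.7 (first and third
displays): the reduced second core `[I J' J; 0 J J']` of `Δ_P` (Lem. 2.2) next to the identity
channel.  [cite: KazeevKhoromskij2012, Cor. 2.7] -/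
def perSupSecond (p : Fin 2 × Fin 2) : Matrix (Fin 3) (Fin 4) K :=
  !![blkI K p, blkJ' K p, blkJ K p, 0; 0, blkJ K p, blkJ' K p, 0; 0, 0, 0, blkI K p]

/-- The bond matrix `diag([1 0 0; 0 1 1], 1) = [1 0 0 0; 0 1 1 0; 0 0 0 1]` (`3 × 4`) of the head of
the `Δ_P` supercores: `[I J' J 0; 0 J J' 0; 0 0 0 I] = diag(L, 1) ⋈ diag(W, I)` and
`[I P 0; 0 0 I] ⋈ diag(L, 1) = E_P ⋈ diag(W, I)` with `L = [1 0 0; 0 1 1]` the bond matrix of Lem. 2.2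
(uniform-form device).  [cite: KazeevKhoromskij2012, Cor. 2.7] -/
def perSupM : Matrix (Fin 3) (Fin 4) K :=
  !![1, 0, 0, 0; 0, 1, 1, 0; 0, 0, 0, 1]

/-- The last QTT core `[a(2I-J-J'); -aJ; -aJ'; I]` (`4 × 1`) of the last supercore
`[a_DΔ^{(d)}; I^{⊗d}]` BEFORE the terminal rank reduction, common to the factors `Δ_DD` (Cor. 2.4)
and `Δ_P` (Cor. 2.7): `diag(W, I) ⋈ (B(a) ⋈ (0, 1)ᵀ)`.  [cite: KazeevKhoromskij2012, Cor. 2.7] -/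
def supLastCol (c : K) (p : Fin 2 × Fin 2) : Matrix (Fin 4) (Fin 1) K :=
  !![c * (2 * blkI K p - blkJ K p - blkJ' K p); -c * blkJ K p; -c * blkJ' K p; blkI K p]

/-- THE QTT TRAIN OF THE `D`-DIMENSIONAL PERIODIC LAPLACIAN `Δ_P^{(d…d)}` (Cor. 2.3 assembled from
the supercores of Cor. 2.7 by Rem. 1.2), in uniform form with bond dimension `4` on `D·d` sites: the
block-diagonal device of Cor. 2.5 run with the rank-`3` Laplace core `W`, the REDUCED periodic
boundary row `(1, 1, 1)` (`[I P] ⋈ [1 0 0; 0 1 1] = (1,1,1) ⋈ W`, Lem. 2.2) and the boundary column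
`(2, -1, -1)`.  [cite: KazeevKhoromskij2012, Cor. 2.7] -/
def lapMultiPTrain (a : ℕ → K) (D d : ℕ) : TensorTrain K (Fin 2 × Fin 2) (D * d) :=
  supTrain K (lapCore K) ![1, 1, 1] ![2, -1, -1] a D d

variable {K}

/-- THE LEFT BOND MATRIX OF COR. 2.7 WRITTEN OUT: `E_P = [1 1 1 0; 0 0 0 1]` for the reduced
periodic boundary row `(1, 1, 1)`.  [cite: KazeevKhoromskij2012, Cor. 2.7] -/
theorem supBondL_per : supBondL K ![(1 : K), 1, 1] = !![1, 1, 1, 0; 0, 0, 0, 1] := by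
  ext i j
  fin_cases i <;> fin_cases j <;> simp [supBondL, Fin.snoc]

/-- THE RIGHT BOND MATRIX OF COR. 2.7 IS THAT OF COR. 2.4: `B(c) = [1 2c; 0 -c; 0 -c; 0 1]`.
[cite: KazeevKhoromskij2012, Cor. 2.7] -/
theorem supBondR_per (c : K) : supBondR K c ![(2 : K), -1, -1] = supR K c := by
  ext i j
  fin_cases i <;> fin_cases j <;> simp [supBondR, supR, Fin.snoc, mul_comm]

/-- `B₁(c) = [1 2c; 0 -c; 0 -c]` (Cor. 2.4's).  [cite: KazeevKhoromskij2012, Cor. 2.7] -/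
theorem supBondR₁_per (c : K) : supBondR₁ K c ![(2 : K), -1, -1] = supR₁ K c := by
  ext i j
  fin_cases i <;> fin_cases j <;> simp [supBondR₁, supR₁, mul_comm]

/-- THE MIDDLE QTT CORE OF COR. 2.7 IS `diag(W, I) = [I J' J 0; 0 J 0 0; 0 0 J' 0; 0 0 0 I]`, the
middle core of Cor. 2.4.  [cite: KazeevKhoromskij2012, Cor. 2.7] -/
theorem supCore_lapCore (p : Fin 2 × Fin 2) : supCore K (lapCore K) p = lapSupCore K p := by
  ext i j
  fin_cases i <;> fin_cases j <;> simp [supCore, lapCore, lapSupCore]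

/-- `[I J' J 0; 0 J J' 0; 0 0 0 I] = diag(L, 1) ⋈ diag(W, I)` (bookkeeping).
[cite: KazeevKhoromskij2012, Cor. 2.7] -/
theorem perSupSecond_eq (p : Fin 2 × Fin 2) :
    perSupSecond K p = perSupM K * supCore K (lapCore K) p := by
  rw [supCore_lapCore]
  ext i j
  fin_cases i <;> fin_cases j <;>
    simp [perSupSecond, perSupM, lapSupCore, Matrix.mul_apply, Fin.sum_univ_four]

/-- THE HEAD OF THE `Δ_P` SUPERCORES: `[I P 0; 0 0 I] ⋈ diag(L, 1) = E_P ⋈ diag(W, I)` — the two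
printed head cores multiply to the first two cores of the uniform form
(`[I P 0; 0 0 I](p₁) · [I J' J 0; 0 J J' 0; 0 0 0 I](p₂) = E_P · diag(W,I)(p₁) · diag(W,I)(p₂)`).
[cite: KazeevKhoromskij2012, Cor. 2.7] -/
theorem perSupFirst_mul_perSupM (p : Fin 2 × Fin 2) :
    perSupFirst K p * perSupM K = supBondL K ![(1 : K), 1, 1] * supCore K (lapCore K) p := by
  rw [supBondL_per, supCore_lapCore]
  ext i j
  fin_cases i <;> fin_cases j <;>
    simp [perSupFirst, perSupM, lapSupCore, Matrix.mul_apply, Fin.sum_univ_three, Fin.sum_univ_four,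
      add_comm]

/-- `[I a(2I-J-J'); 0 -aJ; 0 -aJ'; 0 I] = diag(W, I) ⋈ B(a)` in the notation of the device
(Cor. 2.4's `supLast_eq`).  [cite: KazeevKhoromskij2012, Cor. 2.7] -/
theorem supLast_eq_supCore_mul_supBondR (c : K) (p : Fin 2 × Fin 2) :
    supLast K c p = supCore K (lapCore K) p * supBondR K c ![(2 : K), -1, -1] := by
  rw [supCore_lapCore, supBondR_per]
  exact supLast_eq c p

/-- `[I a(2I-J-J'); 0 -aJ; 0 -aJ'] = W ⋈ B₁(a)` in the notation of the device (Cor. 2.4's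
`supLast₁_eq`).  [cite: KazeevKhoromskij2012, Cor. 2.7] -/
theorem supLast₁_eq_lapCore_mul_supBondR₁ (c : K) (p : Fin 2 × Fin 2) :
    supLast₁ K c p = lapCore K p * supBondR₁ K c ![(2 : K), -1, -1] := by
  rw [supBondR₁_per]
  exact supLast₁_eq c p

/-- `[a(2I-J-J'); -aJ; -aJ'; I] = diag(W, I) ⋈ (B(a) ⋈ (0, 1)ᵀ)` (bookkeeping).
[cite: KazeevKhoromskij2012, Cor. 2.7] -/
theorem supLastCol_eq (c : K) (p : Fin 2 × Fin 2) :
    supLastCol K c p = Matrix.of fun i (_ : Fin 1) =>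
      (supCore K (lapCore K) p *ᵥ (supBondR K c ![(2 : K), -1, -1] *ᵥ ![(0 : K), 1])) i := by
  rw [supBondR_per, supCore_lapCore]
  ext i j
  fin_cases i <;> fin_cases j <;>
    simp [supLastCol, lapSupCore, supR, Matrix.mulVec, dotProduct, Fin.sum_univ_four, Fin.sum_univ_two,
      mul_comm]
  ring

/-- THE JUNCTION CORE OF THE ASSEMBLED `Δ_P` TRAIN WRITTEN OUT:
`diag(W, I) ⋈ B(a) ⋈ E_P = [I I I a(2I-J-J'); 0 0 0 -aJ; 0 0 0 -aJ'; 0 0 0 I]`.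
[cite: KazeevKhoromskij2012, Cor. 2.7] -/
theorem perSupJunction_eq (c : K) (p : Fin 2 × Fin 2) :
    supJunction K (lapCore K) ![(1 : K), 1, 1] ![(2 : K), -1, -1] c p =
      !![blkI K p, blkI K p, blkI K p, c * (2 * blkI K p - blkJ K p - blkJ' K p);
        0, 0, 0, -c * blkJ K p; 0, 0, 0, -c * blkJ' K p; 0, 0, 0, blkI K p] := by
  rw [supJunction, ← supLast_eq_supCore_mul_supBondR, supBondL_per]
  ext i j
  fin_cases i <;> fin_cases j <;> simp [supLast, Matrix.mul_apply, Fin.sum_univ_two]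

/-- [folklore] `(1,0,0,1,1) ⋈ Z = (1,1,1)` (bookkeeping). -/
private theorem vecMul_perZ : ![(1 : K), 0, 0, 1, 1] ᵥ* perZ K = ![1, 1, 1] := by
  ext j
  fin_cases j <;> simp [perZ, Matrix.vecMul, dotProduct, Fin.sum_univ_five]

/-- [folklore] `Z ⋈ (2,-1,-1)ᵀ = (2,-1,-1,-1,-1)ᵀ` (bookkeeping). -/
private theorem perZ_mulVec₃ : perZ K *ᵥ ![(2 : K), -1, -1] = ![2, -1, -1, -1, -1] := by
  ext j
  fin_cases j <;> simp [perZ, Matrix.mulVec, dotProduct, Fin.sum_univ_three]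

/-- THE REDUCED PERIODIC ROW IS THE RANK-`5` ROW SWEPT THROUGH `Z` (Lem. 2.2): for every string of
digit pairs, `(1,1,1) · W(g₀) ⋯ W(g_{d-1}) = ((1,0,0,1,1) · diag(W,J,J')(g₀) ⋯ diag(W,J,J')(g_{d-1})) · Z`
(from `diag(W,J,J')^{⋈} ⋈ Z = Z ⋈ W^{⋈}` and `(1,0,0,1,1) ⋈ Z = (1,1,1)`).
[cite: KazeevKhoromskij2012, Lem. 2.2] -/
theorem vecMul_chainProd_lapCore_per (d : ℕ) (g : Fin d → Fin 2 × Fin 2) :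
    ![(1 : K), 1, 1] ᵥ* TensorTrain.chainProd (fun _ => lapCore K) d g =
      (![(1 : K), 0, 0, 1, 1] ᵥ* TensorTrain.chainProd (fun _ => lapPCore K) d g) ᵥ* perZ K := by
  rw [Matrix.vecMul_vecMul, chainProd_lapPCore_mul_perZ, ← Matrix.vecMul_vecMul, vecMul_perZ]

/-- CHANNEL `0` OF THE REDUCED PERIODIC ROW IS THE DIAGONAL INDICATOR `𝟙[m = n]`.
[cite: KazeevKhoromskij2012, Lem. 2.2] -/
theorem vecMul_chainProd_lapCore_per_zero (d : ℕ) (σ μ : Fin d → Fin 2) :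
    (![(1 : K), 1, 1] ᵥ* TensorTrain.chainProd (fun _ => lapCore K) d (fun r => (σ r, μ r))) 0 =
      (1 : Matrix (Fin (2 ^ d)) (Fin (2 ^ d)) K) (quanticsEquiv 2 d σ) (quanticsEquiv 2 d μ) := by
  rw [vecMul_chainProd_lapCore_per, vecMul_chainProd_lapPCore, Matrix.one_apply]
  simp [lapPVec, perZ, Matrix.vecMul, dotProduct, Fin.sum_univ_five, Fin.val_inj]

/-- THE REDUCED PERIODIC ROW CLOSED BY `(2, -1, -1)ᵀ` IS `Δ_P^{(d)}(m, n)` (Lem. 2.2 in row form,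
every `d ≥ 0` with the convention of `laplaceP` for `2^d ≤ 2`).  [cite: KazeevKhoromskij2012, Lem. 2.2] -/
theorem vecMul_chainProd_lapCore_per_dotProduct (d : ℕ) (σ μ : Fin d → Fin 2) :
    ![(1 : K), 1, 1] ᵥ* TensorTrain.chainProd (fun _ => lapCore K) d (fun r => (σ r, μ r)) ⬝ᵥ
        ![2, -1, -1] =
      laplaceP K (2 ^ d) (quanticsEquiv 2 d σ) (quanticsEquiv 2 d μ) := by
  rw [vecMul_chainProd_lapCore_per, ← Matrix.dotProduct_mulVec, perZ_mulVec₃, ← eval_lapPTrain,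
    lapPTrain, TensorTrain.eval_uniform]

/-- THE MIDDLE SUPERCORE IDENTITY WITH `Δ_P` (uniform form, every `d ≥ 0`):
`E_P · diag(W,I)(i₁,j₁) ⋯ diag(W,I)(i_d,j_d) · B(c) = [𝟙[m=n] cΔ_P^{(d)}(m,n); 0 𝟙[m=n]]`, the block
entry of `[I^{⊗d} cΔ_P^{(d)}; 0 I^{⊗d}]`.  [cite: KazeevKhoromskij2012, Cor. 2.7] -/
theorem supBondL_mul_chainProd_mul_supBondR_per (c : K) (d : ℕ) (σ μ : Fin d → Fin 2) :
    supBondL K ![(1 : K), 1, 1] *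
        TensorTrain.chainProd (fun _ => supCore K (lapCore K)) d (fun r => (σ r, μ r)) *
        supBondR K c ![(2 : K), -1, -1] =
      laplaceMultiCore c (laplaceP K (2 ^ d)) (quanticsEquiv 2 d σ, quanticsEquiv 2 d μ) :=
  supBondL_mul_chainProd_mul_supBondR _ _ _ _ c σ μ (vecMul_chainProd_lapCore_per_zero d σ μ)
    (vecMul_chainProd_lapCore_per_dotProduct d σ μ)

/-- COROLLARY 2.7, MIDDLE SUPERCORE, VERBATIM (`d = k + 3 ≥ 3`): the `((i₁…i_d), (j₁…j_d))` block
entry of `[I P 0; 0 0 I] ⋈ [I J' J 0; 0 J J' 0; 0 0 0 I] ⋈ [I J' J 0; 0 J 0 0; 0 0 J' 0; 0 0 0 I]^{⋈(d-3)}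
⋈ [I a(2I-J-J'); 0 -aJ; 0 -aJ'; 0 I]`, i.e. the `2 × 2` matrix
`perSupFirst(i₁,j₁) · perSupSecond(i₂,j₂) · diag(W,I)(i₃,j₃) ⋯ diag(W,I)(i_{d-1},j_{d-1}) · supLast a (i_d,j_d)`,
is `[𝟙[m=n] aΔ_P^{(d)}(m,n); 0 𝟙[m=n]]` — the block entry of the supercore
`[I^{⊗d} a_kΔ_P^{(d)}; 0 I^{⊗d}]`, a rank-`3, 4 ⋯ 4` QTT representation (the paper states it for
`d ≥ 4`).  [cite: KazeevKhoromskij2012, Cor. 2.7] -/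
theorem perSupFirst_mul_perSupSecond_mul_chainProd_mul_supLast (c : K) (k : ℕ)
    (σ μ : Fin (k + 3) → Fin 2) :
    perSupFirst K (σ 0, μ 0) * perSupSecond K (σ 1, μ 1) *
        TensorTrain.chainProd (fun _ => supCore K (lapCore K)) k
          (fun r : Fin k => (σ r.succ.succ.castSucc, μ r.succ.succ.castSucc)) *
        supLast K c (σ (Fin.last (k + 2)), μ (Fin.last (k + 2))) =
      laplaceMultiCore c (laplaceP K (2 ^ (k + 3)))
        (quanticsEquiv 2 (k + 3) σ, quanticsEquiv 2 (k + 3) μ) := by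
  have hchain : supCore K (lapCore K) (σ 0, μ 0) *
        (supCore K (lapCore K) (σ 1, μ 1) *
          TensorTrain.chainProd (fun _ => supCore K (lapCore K)) k
            (fun r : Fin k => (σ r.succ.succ.castSucc, μ r.succ.succ.castSucc))) *
        supCore K (lapCore K) (σ (Fin.last (k + 2)), μ (Fin.last (k + 2))) =
      TensorTrain.chainProd (fun _ => supCore K (lapCore K)) (k + 3) (fun r => (σ r, μ r)) := by
    rw [TensorTrain.chainProd, TensorTrain.chainProd_succ_eq_mul, TensorTrain.chainProd_succ_eq_mul]
    rfl
  rw [perSupSecond_eq, ← Matrix.mul_assoc (perSupFirst K _), perSupFirst_mul_perSupM,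
    ← supBondL_mul_chainProd_mul_supBondR_per c (k + 3) σ μ, ← hchain,
    supLast_eq_supCore_mul_supBondR]
  simp only [Matrix.mul_assoc]

/-- [folklore] `[I P] ⋈ [1 0 0; 0 1 1] = (I, P, P) = (1,1,1) ⋈ W` as a row matrix (bookkeeping,
`P = J + J'`). -/
private theorem perFirst_mul_perL_eq (p : Fin 2 × Fin 2) :
    perFirst K p * perL K = Matrix.of fun (_ : Fin 1) j => (![(1 : K), 1, 1] ᵥ* lapCore K p) j := by
  ext i j
  fin_cases i; fin_cases j <;>
    simp [perFirst, perL, lapCore, Matrix.mul_apply, Matrix.vecMul, dotProduct, Fin.sum_univ_two,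
      Fin.sum_univ_three, add_comm]

/-- [folklore] A one-row matrix times a matrix (bookkeeping). -/
private theorem rowOf_mul {p q : ℕ} (v : Fin p → K) (X : Matrix (Fin p) (Fin q) K) :
    Matrix.of (fun (_ : Fin 1) j => v j) * X = Matrix.of fun (_ : Fin 1) j => (v ᵥ* X) j := rfl

/-- [folklore] A matrix times a one-column matrix (bookkeeping). -/
private theorem mul_colOf {p q : ℕ} (X : Matrix (Fin p) (Fin q) K) (v : Fin q → K) :
    X * Matrix.of (fun i (_ : Fin 1) => v i) = Matrix.of fun i (_ : Fin 1) => (X *ᵥ v) i := rfl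

/-- COROLLARY 2.7, FIRST SUPERCORE, VERBATIM (`d = k + 3 ≥ 3`): the block entry of
`[I P] ⋈ [I J' J; 0 J J'] ⋈ [I J' J; 0 J 0; 0 0 J']^{⋈(d-3)} ⋈ [I a(2I-J-J'); 0 -aJ; 0 -aJ']`
(the first two cores are the reduced head of `Δ_P`, Lem. 2.2) is `[𝟙[m=n] aΔ_P^{(d)}(m,n)]`, the
block entry of the first supercore `[I^{⊗d} a₁Δ_P^{(d)}]` — a rank-`2, 3 ⋯ 3` QTT representation.
[cite: KazeevKhoromskij2012, Cor. 2.7] -/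
theorem perFirst_mul_perSecond_mul_chainProd_mul_supLast₁ (c : K) (k : ℕ)
    (σ μ : Fin (k + 3) → Fin 2) :
    perFirst K (σ 0, μ 0) * perSecond K (σ 1, μ 1) *
        TensorTrain.chainProd (fun _ => lapCore K) k
          (fun r : Fin k => (σ r.succ.succ.castSucc, μ r.succ.succ.castSucc)) *
        supLast₁ K c (σ (Fin.last (k + 2)), μ (Fin.last (k + 2))) =
      !![(1 : Matrix (Fin (2 ^ (k + 3))) (Fin (2 ^ (k + 3))) K)
          (quanticsEquiv 2 (k + 3) σ) (quanticsEquiv 2 (k + 3) μ),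
        c * laplaceP K (2 ^ (k + 3)) (quanticsEquiv 2 (k + 3) σ) (quanticsEquiv 2 (k + 3) μ)] := by
  have key : (![(1 : K), 1, 1] ᵥ*
        TensorTrain.chainProd (fun _ => lapCore K) (k + 3) (fun r => (σ r, μ r))) ᵥ*
        supBondR₁ K c ![(2 : K), -1, -1] =
      (((![(1 : K), 1, 1] ᵥ* lapCore K (σ 0, μ 0)) ᵥ* lapCore K (σ 1, μ 1)) ᵥ*
        TensorTrain.chainProd (fun _ => lapCore K) k
          (fun r : Fin k => (σ r.succ.succ.castSucc, μ r.succ.succ.castSucc))) ᵥ*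
        (lapCore K (σ (Fin.last (k + 2)), μ (Fin.last (k + 2))) *
          supBondR₁ K c ![(2 : K), -1, -1]) := by
    rw [TensorTrain.chainProd, TensorTrain.chainProd_succ_eq_mul, TensorTrain.chainProd_succ_eq_mul]
    simp only [Matrix.vecMul_vecMul, Matrix.mul_assoc]
    rfl
  ext i j
  fin_cases i
  rw [perSecond_eq, ← Matrix.mul_assoc (perFirst K _), perFirst_mul_perL_eq,
    supLast₁_eq_lapCore_mul_supBondR₁, rowOf_mul, rowOf_mul, rowOf_mul, Matrix.of_apply, ← key,
    vecMul_chainProd_vecMul_supBondR₁ (lapCore K) _ _ (laplaceP K (2 ^ (k + 3))) c σ μ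
      (vecMul_chainProd_lapCore_per_zero (k + 3) σ μ)
      (vecMul_chainProd_lapCore_per_dotProduct (k + 3) σ μ)]
  fin_cases j <;> simp

/-- COROLLARY 2.7, LAST SUPERCORE BEFORE REDUCTION (`d = k + 3 ≥ 3`; the analogue of the first
equality in the proof of Cor. 2.5, not displayed in the paper): the block entry of
`[I P 0; 0 0 I] ⋈ [I J' J 0; 0 J J' 0; 0 0 0 I] ⋈ diag(W, I)^{⋈(d-3)} ⋈ [a(2I-J-J'); -aJ; -aJ'; I]`
is the column `[aΔ_P^{(d)}(m,n); 𝟙[m=n]]`, the block entry of the last supercore `[a_DΔ_P^{(d)}; I^{⊗d}]`.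
[cite: KazeevKhoromskij2012, Cor. 2.7] -/
theorem perSupFirst_mul_perSupSecond_mul_chainProd_mul_supLastCol (c : K) (k : ℕ)
    (σ μ : Fin (k + 3) → Fin 2) :
    perSupFirst K (σ 0, μ 0) * perSupSecond K (σ 1, μ 1) *
        TensorTrain.chainProd (fun _ => supCore K (lapCore K)) k
          (fun r : Fin k => (σ r.succ.succ.castSucc, μ r.succ.succ.castSucc)) *
        supLastCol K c (σ (Fin.last (k + 2)), μ (Fin.last (k + 2))) =
      !![c * laplaceP K (2 ^ (k + 3)) (quanticsEquiv 2 (k + 3) σ) (quanticsEquiv 2 (k + 3) μ);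
        (1 : Matrix (Fin (2 ^ (k + 3))) (Fin (2 ^ (k + 3))) K)
          (quanticsEquiv 2 (k + 3) σ) (quanticsEquiv 2 (k + 3) μ)] := by
  have hchain : supCore K (lapCore K) (σ 0, μ 0) *
        (supCore K (lapCore K) (σ 1, μ 1) *
          TensorTrain.chainProd (fun _ => supCore K (lapCore K)) k
            (fun r : Fin k => (σ r.succ.succ.castSucc, μ r.succ.succ.castSucc))) *
        supCore K (lapCore K) (σ (Fin.last (k + 2)), μ (Fin.last (k + 2))) =
      TensorTrain.chainProd (fun _ => supCore K (lapCore K)) (k + 3) (fun r => (σ r, μ r)) := by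
    rw [TensorTrain.chainProd, TensorTrain.chainProd_succ_eq_mul, TensorTrain.chainProd_succ_eq_mul]
    rfl
  rw [perSupSecond_eq, ← Matrix.mul_assoc (perSupFirst K _), perSupFirst_mul_perSupM,
    ← supBondL_mul_chainProd_mul_col (lapCore K) _ _ (laplaceP K (2 ^ (k + 3))) c σ μ
      (vecMul_chainProd_lapCore_per_zero (k + 3) σ μ)
      (vecMul_chainProd_lapCore_per_dotProduct (k + 3) σ μ),
    ← hchain, supLastCol_eq]
  simp only [Matrix.mul_assoc, mul_colOf]

/-- COROLLARY 2.3 WITH THE SUPERCORES OF COR. 2.7 SUBSTITUTED (Rem. 1.2): for `d ≥ 1` the assembled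
`Δ_P` train evaluates, at the bit-pair string `(τ_ℓ, τ'_ℓ)`, to the entry of
`Σ_k I ⊗ ⋯ ⊗ a_kΔ_P^{(d)} ⊗ ⋯ ⊗ I` at the serialised multi-indices.
[cite: KazeevKhoromskij2012, Cor. 2.7] -/
theorem eval_lapMultiPTrain (a : ℕ → K) (D d : ℕ) (hd : 0 < d) (τ τ' : Fin (D * d) → Fin 2) :
    (lapMultiPTrain K a D d).eval (fun ℓ => (τ ℓ, τ' ℓ)) =
      laplaceMulti (fun k : Fin D => a k) (fun _ => laplaceP K (2 ^ d)) (serialEquiv 2 D d τ)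
        (serialEquiv 2 D d τ') :=
  eval_supTrain (lapCore K) _ _ a D d hd (laplaceP K (2 ^ d)) (vecMul_chainProd_lapCore_per_zero d)
    (vecMul_chainProd_lapCore_per_dotProduct d) τ τ'

/-- THE QTT DECOMPOSITION OF THE `D`-DIMENSIONAL PERIODIC LAPLACE OPERATOR (Cor. 2.3 + Cor. 2.7,
uniform grids `2^d × ⋯ × 2^d`, `d ≥ 1`): the TT matrix of the assembled train is
`Σ_k I ⊗ ⋯ ⊗ a_kΔ_P^{(2^d)} ⊗ ⋯ ⊗ I` with its multi-indices serialised dimension by dimension.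
[cite: KazeevKhoromskij2012, Cor. 2.7] -/
theorem ttMatrix_lapMultiPTrain (a : ℕ → K) (D d : ℕ) (hd : 0 < d) :
    (lapMultiPTrain K a D d).ttMatrix =
      (laplaceMulti (fun k : Fin D => a k) (fun _ => laplaceP K (2 ^ d))).submatrix
        (serialEquiv 2 D d) (serialEquiv 2 D d) :=
  ttMatrix_supTrain (lapCore K) _ _ a D d hd (laplaceP K (2 ^ d))
    (vecMul_chainProd_lapCore_per_zero d) (vecMul_chainProd_lapCore_per_dotProduct d)

end PeriodicBonds

section PeriodicReduced

variable {K : Type u} [Field K]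

/-- `[aI aJ' aJ; 0 aJ 0; 0 0 aJ'; ½I -½I -½I] = diag(W, I) ⋈ Z(a)` in the notation of the device
(Cor. 2.4's `supPenult_eq`).  [cite: KazeevKhoromskij2012, Cor. 2.7] -/
theorem supPenult_eq_supCore_mul_supZ (c : K) (p : Fin 2 × Fin 2) :
    supPenult K c p = supCore K (lapCore K) p * supZ K c := by
  rw [supCore_lapCore]
  exact supPenult_eq c p

/-- THE SWEEP OF THE THIRD DISPLAY in the notation of the device:
`Z(c) · (W ⋈ (2,-1,-1)ᵀ) = diag(W, I) · (B(c) ⋈ (0,1)ᵀ)` (Cor. 2.4's `supZ_mulVec_lapCore_mulVec`;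
requires `2 ≠ 0` in `K`).  [cite: KazeevKhoromskij2012, Cor. 2.7] -/
theorem supZ_mulVec_lapCore_mulVec_per [NeZero (2 : K)] (c : K) (p : Fin 2 × Fin 2) :
    supZ K c *ᵥ (lapCore K p *ᵥ ![(2 : K), -1, -1]) =
      supCore K (lapCore K) p *ᵥ (supBondR K c ![(2 : K), -1, -1] *ᵥ ![(0 : K), 1]) := by
  rw [supCore_lapCore, supBondR_per]
  exact supZ_mulVec_lapCore_mulVec c p

/-- [folklore] The last core of Lem. 2.1 is `W ⋈ (2, -1, -1)ᵀ` as a column matrix (bookkeeping). -/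
private theorem lapLast_eq_colOf (p : Fin 2 × Fin 2) :
    lapLast K p = Matrix.of fun i (_ : Fin 1) => (lapCore K p *ᵥ ![(2 : K), -1, -1]) i := by
  ext i j
  fin_cases j; fin_cases i <;>
    simp [lapLast, lapCore, Matrix.mulVec, dotProduct, Fin.sum_univ_three]
  ring

/-- COROLLARY 2.7, LAST SUPERCORE, VERBATIM (`d = k + 4 ≥ 4`, `2 ≠ 0` in `K`): the block entry of
`[I P 0; 0 0 I] ⋈ [I J' J 0; 0 J J' 0; 0 0 0 I] ⋈ [I J' J 0; 0 J 0 0; 0 0 J' 0; 0 0 0 I]^{⋈(d-4)}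
   ⋈ [aI aJ' aJ; 0 aJ 0; 0 0 aJ'; ½I -½I -½I] ⋈ [2I-J-J'; -J; -J']`
is `[aΔ_P^{(d)}(m,n); 𝟙[m=n]]`, the block entry of the last supercore `[a_DΔ_P^{(d)}; I^{⊗d}]` — a
rank-`3, 4 ⋯ 4, 3` QTT representation.  [cite: KazeevKhoromskij2012, Cor. 2.7] -/
theorem perSupFirst_mul_perSupSecond_mul_chainProd_mul_supPenult_mul_lapLast [NeZero (2 : K)]
    (c : K) (k : ℕ) (σ μ : Fin (k + 4) → Fin 2) :
    perSupFirst K (σ 0, μ 0) * perSupSecond K (σ 1, μ 1) *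
        TensorTrain.chainProd (fun _ => supCore K (lapCore K)) k
          (fun r : Fin k => (σ r.succ.succ.castSucc.castSucc, μ r.succ.succ.castSucc.castSucc)) *
        supPenult K c (σ (Fin.last (k + 2)).castSucc, μ (Fin.last (k + 2)).castSucc) *
        lapLast K (σ (Fin.last (k + 3)), μ (Fin.last (k + 3))) =
      !![c * laplaceP K (2 ^ (k + 4)) (quanticsEquiv 2 (k + 4) σ) (quanticsEquiv 2 (k + 4) μ);
        (1 : Matrix (Fin (2 ^ (k + 4))) (Fin (2 ^ (k + 4))) K)
          (quanticsEquiv 2 (k + 4) σ) (quanticsEquiv 2 (k + 4) μ)] := by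
  have hchain : supCore K (lapCore K) (σ 0, μ 0) *
        (supCore K (lapCore K) (σ 1, μ 1) *
          TensorTrain.chainProd (fun _ => supCore K (lapCore K)) k
            (fun r : Fin k =>
              (σ r.succ.succ.castSucc.castSucc, μ r.succ.succ.castSucc.castSucc))) *
        supCore K (lapCore K) (σ (Fin.last (k + 2)).castSucc, μ (Fin.last (k + 2)).castSucc) *
        supCore K (lapCore K) (σ (Fin.last (k + 3)), μ (Fin.last (k + 3))) =
      TensorTrain.chainProd (fun _ => supCore K (lapCore K)) (k + 4) (fun r => (σ r, μ r)) := by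
    rw [TensorTrain.chainProd, TensorTrain.chainProd, TensorTrain.chainProd_succ_eq_mul,
      TensorTrain.chainProd_succ_eq_mul]
    rfl
  rw [perSupSecond_eq, ← Matrix.mul_assoc (perSupFirst K _), perSupFirst_mul_perSupM,
    ← supBondL_mul_chainProd_mul_col (lapCore K) _ _ (laplaceP K (2 ^ (k + 4))) c σ μ
      (vecMul_chainProd_lapCore_per_zero (k + 4) σ μ)
      (vecMul_chainProd_lapCore_per_dotProduct (k + 4) σ μ),
    ← hchain, supPenult_eq_supCore_mul_supZ, lapLast_eq_colOf]
  simp only [Matrix.mul_assoc, mul_colOf, supZ_mulVec_lapCore_mulVec_per]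

end PeriodicReduced

section PeriodicRanks

variable {K : Type u} [Field K]

/-- THEOREM 4.1 FOR `Δ_P^{(d…d)}`, THE `4`s: every unfolding matrix of the assembled train has rank
`≤ 4` (line `2, 3…3, 2, 3, 4…4, 2, …, 2, 3, 4…4, 3`).  [cite: KazeevKhoromskij2012, Thm. 4.1] -/
theorem rank_unfolding_lapMultiPTrain_le (a : ℕ → K) (D d k m : ℕ) (h : k + m = D * d) :
    (Matrix.of fun (s : Fin k → Fin 2 × Fin 2) (t : Fin m → Fin 2 × Fin 2) =>
        (lapMultiPTrain K a D d).eval (fun i => Fin.append s t (i.cast h.symm))).rank ≤ 4 :=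
  rank_unfolding_supTrain_le (lapCore K) _ _ a D d k m h

/-- THEOREM 4.1 FOR `Δ_P^{(d…d)}`, THE `2`s BETWEEN DIMENSIONS: across the bond after the last site
of each dimension the unfolding rank is `≤ 2`.  [cite: KazeevKhoromskij2012, Thm. 4.1] -/
theorem rank_unfolding_lapMultiPTrain_junction_le (a : ℕ → K) (D d ℓ m : ℕ) (hℓ : ℓ % d = d - 1)
    (h : ℓ + 1 + m = D * d) :
    (Matrix.of fun (s : Fin (ℓ + 1) → Fin 2 × Fin 2) (t : Fin m → Fin 2 × Fin 2) =>
        (lapMultiPTrain K a D d).eval (fun i => Fin.append s t (i.cast h.symm))).rank ≤ 2 :=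
  rank_unfolding_supTrain_junction_le (lapCore K) _ _ a D d ℓ m hℓ h

/-- THEOREM 4.1 FOR `Δ_P^{(d…d)}`, THE LEADING `3…3`: inside the first supercore (after `k < d`
sites) the unfolding rank is `≤ 3`.  [cite: KazeevKhoromskij2012, Thm. 4.1] -/
theorem rank_unfolding_lapMultiPTrain_head_le (a : ℕ → K) (D d k m : ℕ) (hk : k < d)
    (h : k + m = D * d) :
    (Matrix.of fun (s : Fin k → Fin 2 × Fin 2) (t : Fin m → Fin 2 × Fin 2) =>
        (lapMultiPTrain K a D d).eval (fun i => Fin.append s t (i.cast h.symm))).rank ≤ 3 :=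
  rank_unfolding_supTrain_head_le (lapCore K) _ _ a D d k m hk h

/-- [folklore] Row form of the head reduction of `Δ_P` (Lem. 2.2): `[I P] ⋈ [1 0 0; 0 1 1] = (1,1,1) ⋈ W`,
i.e. `(I, P) · L = (I, P, P)` (bookkeeping, `P = J + J'`). -/
private theorem vecMul_perL (p : Fin 2 × Fin 2) :
    ![blkI K p, blkJ K p + blkJ' K p] ᵥ* perL K = ![(1 : K), 1, 1] ᵥ* lapCore K p := by
  obtain ⟨a, a'⟩ := p
  ext j
  fin_cases a <;> fin_cases a' <;> fin_cases j <;>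
    simp [perL, lapCore, blkI, blkJ, blkJ', Matrix.vecMul, dotProduct, Fin.sum_univ_two,
      Fin.sum_univ_three]

/-- THEOREM 4.1 FOR `Δ_P^{(d…d)}`, THE LEADING `2` (`d ≥ 2`): across the very first bond the
unfolding rank is `≤ 2` (the reduced first core `[I P]` of Lem. 2.2 / Cor. 2.7's second display).
[cite: KazeevKhoromskij2012, Thm. 4.1] -/
theorem rank_unfolding_lapMultiPTrain_first_le (a : ℕ → K) (D d m : ℕ) (hd : 1 < d)
    (h : 1 + m = D * d) :
    (Matrix.of fun (s : Fin 1 → Fin 2 × Fin 2) (t : Fin m → Fin 2 × Fin 2) =>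
        (lapMultiPTrain K a D d).eval (fun i => Fin.append s t (i.cast h.symm))).rank ≤ 2 :=
  rank_unfolding_supTrain_first_le_of (lapCore K) _ _ a D d m hd h (perL K * supEmbed K (n := 3))
    (fun p => ![blkI K p, blkJ K p + blkJ' K p]) fun p => by
      rw [vecMul_supCore, Fin.init_snoc, Fin.snoc_last, zero_mul, ← Matrix.vecMul_vecMul,
        vecMul_perL, vecMul_supEmbed]

/-- THEOREM 4.1 FOR `Δ_P^{(d…d)}`, THE `3` OPENING EACH LATER SUPERCORE (`d ≥ 2`): across the bond
after the first site of every dimension `k ≥ 1` the unfolding rank is `≤ 3` (the head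
`[I P 0; 0 0 I] ⋈ diag(L, 1)` of Cor. 2.7).  [cite: KazeevKhoromskij2012, Thm. 4.1] -/
theorem rank_unfolding_lapMultiPTrain_postJunction_le (a : ℕ → K) (D d ℓ m : ℕ) (hd : 1 < d)
    (hℓ : ℓ % d = d - 1) (h : ℓ + 2 + m = D * d) :
    (Matrix.of fun (s : Fin (ℓ + 2) → Fin 2 × Fin 2) (t : Fin m → Fin 2 × Fin 2) =>
        (lapMultiPTrain K a D d).eval (fun i => Fin.append s t (i.cast h.symm))).rank ≤ 3 :=
  rank_unfolding_supTrain_postJunction_le_of (lapCore K) _ _ a D d ℓ m hd hℓ h (perSupM K)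
    (fun p => perSupFirst K p) fun p => (perSupFirst_mul_perSupM p).symm

/-- [folklore] The column entering the last site factors through `lastZ` (bookkeeping; the column is
the one of Cor. 2.4: `diag(W,I)(p) · (2c,-c,-c,1)ᵀ = Z₃(c) · (-cJ, -cJ', I)(p)`). -/
private theorem supCore_lapCore_mulVec (c : K) (p : Fin 2 × Fin 2) :
    supCore K (lapCore K) p *ᵥ (supBondR K c ![(2 : K), -1, -1] *ᵥ ![(0 : K), 1]) =
      lastZ c *ᵥ ![-c * blkJ K p, -c * blkJ' K p, blkI K p] := by
  rw [supCore_lapCore, supBondR_per]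
  obtain ⟨a, a'⟩ := p
  ext j
  fin_cases a <;> fin_cases a' <;> fin_cases j <;>
    simp [lapSupCore, supR, lastZ, blkI, blkJ, blkJ', Matrix.mulVec, dotProduct, Fin.sum_univ_two,
      Fin.sum_univ_three, Fin.sum_univ_four]

/-- THEOREM 4.1 FOR `Δ_P^{(d…d)}`, THE TRAILING `3`: across the very last bond the unfolding rank is
`≤ 3` (the `4 × 3` penultimate core of Cor. 2.7's third display).
[cite: KazeevKhoromskij2012, Thm. 4.1] -/
theorem rank_unfolding_lapMultiPTrain_last_le (a : ℕ → K) (D d k : ℕ) (h : k + 1 = D * d) :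
    (Matrix.of fun (s : Fin k → Fin 2 × Fin 2) (t : Fin 1 → Fin 2 × Fin 2) =>
        (lapMultiPTrain K a D d).eval (fun i => Fin.append s t (i.cast h.symm))).rank ≤ 3 :=
  rank_unfolding_supTrain_last_le_of (lapCore K) _ _ a D d k h (fun c => lastZ c)
    (fun c p => ![-c * blkJ K p, -c * blkJ' K p, blkI K p]) (supCore_lapCore_mulVec)

end PeriodicRanks

end Literature.LinearAlgebra.TensorNetworks
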